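import Mathlib
import Literature.AlgebraicGeometry.CossartPiltant200819.OrderAtClosedPoint2009
import HarnessLib

/-!
# Route `RadicialJung`, crux `CleanModels` (stmt-ResolutionOfSingularities-15917), line `Sketch` rev 35, stub 6 `stub_cleanProp44` (X44c):
# THE HIGHER-ORDER BIRTH TEST — `ν − 1 ≤ ord(D U)` relative to a curve ideal, at a closed point, with denominators

Seat decomp-res-hand-2 g20 (structural hand).  Item (iii) of the hand-2 g19 census / memo 4e §2.6 (b)–(c): at a closed point `c'` of a created
line the BIRTH ORDER of the tracked unit `U` relative to the curve ideal `N` is `ν(c') := sup_{c} ord(U − c^p mod N)`, a birth is `2 ≤ ν < ∞`, and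
«a derivation kills `p`-th powers and lowers orders by at most one», so `ν(c') ≤ 1 + ord_{c'}(D U)`.  Hand-2 g18 typed the FIRST-ORDER case
(✓ `sub_pow_not_mem_map_sup_sq_of_derivation`: `D(φ b) ∉ Q` ⟹ `b − c'^p ∉ K O_q + 𝔪²` for every `c'` in the local ring); THIS FILE is the test AT
EVERY ORDER, in the same three layers (pure local algebra, def-free; «order `≥ e` along `I`» is written `∈ J ⊔ I^e`, no definition introduced):

* §1 (one ring `E` of characteristic `p`, derivation `D`, curve ideal `J`, point ideal `I`, `D` tangent to `J` to order `n`: `D J ⊆ J + I^n`):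
  `derivation_apply_mem_sup_pow_of_sub_pow_mem` — `b − c^p ∈ J + I^{n+1}` ⟹ `D b ∈ J + I^n`; contrapositive `sub_pow_not_mem_sup_pow_succ_of_derivation`
  — `D b ∉ J + I^n` ⟹ `b − c^p ∉ J + I^{n+1}` for EVERY `c` («`ν ≤ n`»).  (`J = ⊥`: the tree's ✓ `derivation_apply_mem_pow_of_add_pow_mem`.)
* §2 (transport along `φ : O → E` with `φ K ⊆ J`, `φ q ⊆ I` — restriction to the exceptional divisor / to the curve): `sub_pow_not_mem_sup_pow_succ_of_derivation_comap`.
* §3 (denominators: the local ring `O'` of the CLOSED point `q`, `q` maximal): `exists_mul_sub_one_mem_pow` (units modulo `q^{n+1}`),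
  `exists_sub_pow_mem_sup_pow_of_localization` — if `b − c'^p ∈ K O' + 𝔪'^{n+1}` for some `c' ∈ O'` then already `b − c^p ∈ K + q^{n+1}` for some
  `c ∈ O` (so `ν` may be computed before localizing), and THE TEST `sub_pow_not_mem_map_sup_pow_succ_of_derivation`: `D(φ b) ∉ J + I^n` ⟹
  `b − c'^p ∉ K O' + 𝔪'^{n+1}` for every `c' ∈ O'`.
* §4 (the curve form, `J = ⊥`: `E` = functions on the line, e.g. `κ[w]`, `I = (P)`): `sub_pow_not_mem_map_sup_pow_succ_of_derivation_curve` — if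
  `P^n ∤ D F` for the restriction `F = φ U` then `ν < n + 1` at `(P)`; together with ✓ `…CleanProp44BirthCount.sum_mul_natDegree_le_of_add_pow_mem`
  (`Σ (ν − 1)[κ(c'):κ] ≤ deg D F`) this is memo 4e §2.6 (c) in kernel form, for every residue field.

Honest framing: OURS, elementary; a TOOL for the termination author of (iii) (the link `δ*(c') ≤ ν(c')`, memo §2.6 (b), is NOT typed).  Nothing here
proves X44c, any case of `CleanModels`, or resolution of singularities in characteristic `p`.  Setting only: [cite: CossartPiltant2009, ch.1 II.5.3.2 (i)]
[cite: CossartPiltant2019, Theorem 3.6 (proof: «derivatives decrease orders by at most one»)] [cite: StacksProject, Tag 07PF].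
-/

noncomputable section

set_option linter.dupNamespace false -- mandated namespace of this single-conjunct summit

open IsLocalRing
open Literature.AlgebraicGeometry.CossartPiltant200819.OrderAtClosedPoint

namespace Summit.ResolutionOfSingularities.ResolutionOfSingularities.Theorems.RadicialJung.CleanModels

/-! ## §1 One ring: a derivation tangent to the curve bounds the birth order -/

section OneRing

variable {E : Type*} [CommRing E] (p : ℕ) [CharP E p] (D : Derivation ℤ E E) (J I : Ideal E) (n : ℕ)

/-- **`b − c^p ∈ J + I^{n+1}` ⟹ `D b ∈ J + I^n`** when `D J ⊆ J + I^n` (`D` tangent to the curve `V(J)` to order `n` at the point `V(I)`):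
derivations kill `p`-th powers and lower `I`-adic orders by at most one. [cite: CossartPiltant2019, Theorem 3.6 (proof)] -/
theorem derivation_apply_mem_sup_pow_of_sub_pow_mem (hJ : ∀ x ∈ J, D x ∈ J ⊔ I ^ n) {b c : E}
    (h : b - c ^ p ∈ J ⊔ I ^ (n + 1)) : D b ∈ J ⊔ I ^ n := by
  obtain ⟨j, hj, r, hr, hjr⟩ := Submodule.mem_sup.mp h
  have hD : D b = D j + D r := by
    have h1 : D (b - c ^ p) = D b := by rw [map_sub, derivation_apply_pow_char p D c, sub_zero]
    rw [← h1, ← hjr, map_add]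
  rw [hD]
  exact Ideal.add_mem _ (hJ j hj) (Ideal.mem_sup_right (derivation_apply_mem_pow D I n hr))

/-- **THE TEST, one ring**: `D J ⊆ J + I^n` and `D b ∉ J + I^n` ⟹ `b − c^p ∉ J + I^{n+1}` for EVERY `c` («`ν(b; J, I) ≤ n`»).
[cite: CossartPiltant2009, ch.1 II.5.3.2 (i)] -/
theorem sub_pow_not_mem_sup_pow_succ_of_derivation (hJ : ∀ x ∈ J, D x ∈ J ⊔ I ^ n) {b : E} (hb : D b ∉ J ⊔ I ^ n) (c : E) :
    b - c ^ p ∉ J ⊔ I ^ (n + 1) :=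
  fun h => hb (derivation_apply_mem_sup_pow_of_sub_pow_mem p D J I n hJ h)

/-- The same with the `p`-th power ADDED (`b + c^p`, the shape of ✓ `derivation_apply_mem_pow_of_add_pow_mem`). [folklore] -/
theorem add_pow_not_mem_sup_pow_succ_of_derivation [hp : Fact p.Prime] (hJ : ∀ x ∈ J, D x ∈ J ⊔ I ^ n) {b : E} (hb : D b ∉ J ⊔ I ^ n) (c : E) :
    b + c ^ p ∉ J ⊔ I ^ (n + 1) := by
  have h := sub_pow_not_mem_sup_pow_succ_of_derivation p D J I n hJ hb (-c)
  rcases hp.out.eq_two_or_odd' with rfl | hodd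
  · rwa [neg_sq, CharTwo.sub_eq_add] at h
  · rwa [hodd.neg_pow, sub_neg_eq_add] at h

end OneRing

/-! ## §2 Transport along a ring map (restriction to the exceptional divisor / to the curve) -/

section Transport

variable {O E : Type*} [CommRing O] [CommRing E] (φ : O →+* E) (p : ℕ) [CharP E p] (D : Derivation ℤ E E)
  (K q : Ideal O) (J I : Ideal E) (n : ℕ)

/-- Transport of `K + q^{n+1}` along `φ` with `φ K ⊆ J`, `φ q ⊆ I`. [folklore] -/
theorem map_mem_sup_pow_of_mem_sup_pow (hKJ : ∀ x ∈ K, φ x ∈ J) (hqI : ∀ x ∈ q, φ x ∈ I) {m : ℕ} {x : O} (hx : x ∈ K ⊔ q ^ m) :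
    φ x ∈ J ⊔ I ^ m := by
  have hK : K.map φ ≤ J := Ideal.map_le_iff_le_comap.mpr fun y hy => Ideal.mem_comap.mpr (hKJ y hy)
  have hq : (q ^ m).map φ ≤ I ^ m := by
    rw [Ideal.map_pow]
    exact Ideal.pow_right_mono (Ideal.map_le_iff_le_comap.mpr fun y hy => Ideal.mem_comap.mpr (hqI y hy)) m
  have h1 : φ x ∈ (K ⊔ q ^ m).map φ := Ideal.mem_map_of_mem φ hx
  rw [Ideal.map_sup] at h1
  exact sup_le_sup hK hq h1

/-- **THE TEST, transported**: `φ K ⊆ J`, `φ q ⊆ I`, `D J ⊆ J + I^n`, `D(φ b) ∉ J + I^n` ⟹ `b − c^p ∉ K + q^{n+1}` for every `c ∈ O`.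
[cite: CossartPiltant2009, ch.1 II.5.3.2 (i)] -/
theorem sub_pow_not_mem_sup_pow_succ_of_derivation_comap (hKJ : ∀ x ∈ K, φ x ∈ J) (hqI : ∀ x ∈ q, φ x ∈ I)
    (hJ : ∀ x ∈ J, D x ∈ J ⊔ I ^ n) {b : O} (hb : D (φ b) ∉ J ⊔ I ^ n) (c : O) : b - c ^ p ∉ K ⊔ q ^ (n + 1) := by
  intro h
  have h1 := map_mem_sup_pow_of_mem_sup_pow φ K q J I hKJ hqI h
  rw [map_sub, map_pow] at h1
  exact sub_pow_not_mem_sup_pow_succ_of_derivation p D J I n hJ hb (φ c) h1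

end Transport

/-! ## §3 Denominators: the local ring of a closed point -/

section Local

variable {O : Type*} [CommRing O] (q : Ideal O) [hq : q.IsMaximal]

/-- **Units modulo `q^{n+1}`** (`q` maximal): for `m ∉ q` there is `m'` with `m m' − 1 ∈ q^{n+1}` (`m m₀ = 1 − t`, `t ∈ q`;
`m' := m₀ Σ_{i ≤ n} t^i`, `m m' = 1 − t^{n+1}`). [folklore] -/
theorem exists_mul_sub_one_mem_pow {m : O} (hm : m ∉ q) (n : ℕ) : ∃ m' : O, m * m' - 1 ∈ q ^ (n + 1) := by
  classical
  -- invert `m` modulo `q`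
  obtain ⟨m₀, hm₀⟩ : ∃ m₀ : O, m * m₀ - 1 ∈ q := by
    obtain ⟨y, i, hi, hyi⟩ := hq.exists_inv hm
    refine ⟨y, ?_⟩
    have h1 : m * y - 1 = -i := by rw [← hyi]; ring
    rw [h1]
    exact neg_mem hi
  set t := 1 - m * m₀ with ht
  have htq : t ∈ q := by
    rw [ht, ← neg_sub]
    exact q.neg_mem hm₀
  refine ⟨m₀ * ∑ i ∈ Finset.range (n + 1), t ^ i, ?_⟩
  have key : m * (m₀ * ∑ i ∈ Finset.range (n + 1), t ^ i) - 1 = -(t ^ (n + 1)) := by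
    have h1 : m * m₀ = 1 - t := by rw [ht]; ring
    rw [← mul_assoc, h1, mul_neg_geom_sum]
    ring
  rw [key]
  exact neg_mem (Ideal.pow_mem_pow htq _)

variable {O' : Type*} [CommRing O'] [Algebra O O'] [IsLocalization.AtPrime O' q]

/-- Pull-back to `O` of membership in `(K + q^{n+1}) O'` (`q` maximal): `x/1 ∈ (K + q^{n+1}) O'` ⟹ `x ∈ K + q^{n+1}`. [folklore] -/
theorem mem_sup_pow_of_algebraMap_mem_map (K : Ideal O) (n : ℕ) {x : O}
    (hx : algebraMap O O' x ∈ (K ⊔ q ^ (n + 1)).map (algebraMap O O')) : x ∈ K ⊔ q ^ (n + 1) := by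
  obtain ⟨m, hm, hmx⟩ := (IsLocalization.algebraMap_mem_map_algebraMap_iff q.primeCompl O' (K ⊔ q ^ (n + 1)) x).mp hx
  obtain ⟨m', hm'⟩ := exists_mul_sub_one_mem_pow q (Ideal.mem_primeCompl_iff.mp hm) n
  have h1 : x = m' * (m * x) - (m * m' - 1) * x := by ring
  rw [h1]
  exact Ideal.sub_mem _ (Ideal.mul_mem_left _ _ hmx) (Ideal.mem_sup_right (Ideal.mul_mem_right _ _ hm'))

/-- **`ν` may be computed before localizing** (`q` maximal, `O'` its local ring): if `b − c'^p ∈ K O' + (q O')^{n+1}` for some `c' ∈ O'`, then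
`b − c^p ∈ K + q^{n+1}` for some `c ∈ O` (`c' = a/s`; replace `1/s` by an inverse of `s` modulo `q^{n+1}`; Frobenius). [folklore] -/
theorem exists_sub_pow_mem_sup_pow_of_localization (p : ℕ) [hp : Fact p.Prime] [CharP O' p] (K : Ideal O) (n : ℕ)
    {b : O} {c' : O'} (h : algebraMap O O' b - c' ^ p ∈ K.map (algebraMap O O') ⊔ (q.map (algebraMap O O')) ^ (n + 1)) :
    ∃ c : O, b - c ^ p ∈ K ⊔ q ^ (n + 1) := by
  obtain ⟨a, s, rfl⟩ := IsLocalization.exists_mk'_eq q.primeCompl c'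
  obtain ⟨s', hs'⟩ := exists_mul_sub_one_mem_pow q (Ideal.mem_primeCompl_iff.mp s.2) n
  refine ⟨a * s', mem_sup_pow_of_algebraMap_mem_map q (O' := O') K n ?_⟩
  -- `a/s − a s' = −(a/s)(s s' − 1) ∈ q^{n+1} O'`
  have hdiff : IsLocalization.mk' O' a s - algebraMap O O' (a * s') ∈ (q.map (algebraMap O O')) ^ (n + 1) := by
    have hs : IsLocalization.mk' O' a s * algebraMap O O' (s : O) = algebraMap O O' a := IsLocalization.mk'_spec O' a s
    have h1 : IsLocalization.mk' O' a s - algebraMap O O' (a * s') =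
        -(IsLocalization.mk' O' a s * algebraMap O O' ((s : O) * s' - 1)) := by
      rw [map_sub, map_mul, map_one, map_mul]
      linear_combination (algebraMap O O' s') * hs
    rw [h1, ← Ideal.map_pow]
    exact neg_mem (Ideal.mul_mem_left _ _ (Ideal.mem_map_of_mem _ hs'))
  -- Frobenius: `(a/s)^p − (a s')^p = (a/s − a s')^p`
  have hpow : IsLocalization.mk' O' a s ^ p - algebraMap O O' (a * s') ^ p ∈ (q.map (algebraMap O O')) ^ (n + 1) := by
    rw [← sub_pow_char (R := O') ]
    exact Ideal.pow_le_self hp.out.ne_zero (Ideal.pow_mem_pow hdiff p)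
  have h2 : algebraMap O O' (b - (a * s') ^ p) =
      (algebraMap O O' b - IsLocalization.mk' O' a s ^ p) + (IsLocalization.mk' O' a s ^ p - algebraMap O O' (a * s') ^ p) := by
    rw [map_sub, map_pow]; ring
  rw [h2, Ideal.map_sup, Ideal.map_pow]
  exact Ideal.add_mem _ h (Ideal.mem_sup_right hpow)

/-- **THE HIGHER-ORDER BIRTH TEST at a closed point** (g18's ✓ `sub_pow_not_mem_map_sup_sq_of_derivation` at every order): `q ⊂ O` maximal with local
ring `O'`, `φ : O → E` into characteristic `p` with `φ K ⊆ J`, `φ q ⊆ I`, a derivation `D` of `E` tangent to `J` to order `n` (`D J ⊆ J + I^n`) and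
`b ∈ O` with `D(φ b) ∉ J + I^n`.  Then for EVERY `c' ∈ O'`: `b − c'^p ∉ K O' + 𝔪_{O'}^{n+1}` — the birth order of `b` for the curve `K` at `q` is
`≤ n`. [cite: CossartPiltant2009, ch.1 II.5.3.2 (i)] [cite: StacksProject, Tag 07PF] -/
theorem sub_pow_not_mem_map_sup_pow_succ_of_derivation [IsLocalRing O'] {E : Type*} [CommRing E] (φ : O →+* E) (p : ℕ)
    [hp : Fact p.Prime] [CharP E p] [CharP O' p] (D : Derivation ℤ E E) (K : Ideal O) (J I : Ideal E) (n : ℕ)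
    (hKJ : ∀ x ∈ K, φ x ∈ J) (hqI : ∀ x ∈ q, φ x ∈ I) (hJ : ∀ x ∈ J, D x ∈ J ⊔ I ^ n) {b : O} (hb : D (φ b) ∉ J ⊔ I ^ n) (c' : O') :
    algebraMap O O' b - c' ^ p ∉ K.map (algebraMap O O') ⊔ maximalIdeal O' ^ (n + 1) := by
  intro h
  rw [← IsLocalization.AtPrime.map_eq_maximalIdeal q O'] at h
  obtain ⟨c, hc⟩ := exists_sub_pow_mem_sup_pow_of_localization q p K n h
  exact sub_pow_not_mem_sup_pow_succ_of_derivation_comap φ p D K q J I n hKJ hqI hJ hb c hc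

end Local

/-! ## §4 The curve form (`J = ⊥`): restriction to the line and a uniformizer test -/

section Curve

variable {O : Type*} [CommRing O] (q : Ideal O) [hq : q.IsMaximal] {O' : Type*} [CommRing O'] [IsLocalRing O'] [Algebra O O']
  [IsLocalization.AtPrime O' q] {E : Type*} [CommRing E] (φ : O →+* E) (p : ℕ) [hp : Fact p.Prime] [CharP E p] [CharP O' p]

/-- **The curve form of the test**: `φ : O → E` the restriction to the curve (`φ K = 0`), `I ⊆ E` the point with `φ q ⊆ I`, `D` ANY derivation of `E`
(coordinate derivation, or w.r.t. constants).  If `D(φ b) ∉ I^n` then `b − c'^p ∉ K O' + 𝔪'^{n+1}` for every `c'` in the local ring: `ν ≤ n`.  With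
`E = κ[w]`, `I = (P)`: `P^n ∤ D F` (`F = φ b`) bounds the birth order at the closed point `(P)` by `n`, and ✓ `sum_mul_natDegree_le_of_add_pow_mem`
(`…CleanProp44BirthCount`) sums these bounds over the line. [cite: CossartPiltant2009, ch.1 II.5.3.2 (i)] -/
theorem sub_pow_not_mem_map_sup_pow_succ_of_derivation_curve (D : Derivation ℤ E E) (K : Ideal O) (I : Ideal E) (n : ℕ)
    (hK : ∀ x ∈ K, φ x = 0) (hqI : ∀ x ∈ q, φ x ∈ I) {b : O} (hb : D (φ b) ∉ I ^ n) (c' : O') :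
    algebraMap O O' b - c' ^ p ∉ K.map (algebraMap O O') ⊔ maximalIdeal O' ^ (n + 1) := by
  refine sub_pow_not_mem_map_sup_pow_succ_of_derivation q φ p D K ⊥ I n (fun x hx => by rw [hK x hx]; exact zero_mem _) hqI
    (fun x hx => by rw [(Submodule.mem_bot E).mp hx, map_zero]; exact zero_mem _) ?_ c'
  rwa [bot_sup_eq]

/-- **Uniformizer reading in one variable**: for `E = κ[w]` and the closed point `(P)`, `D F ∉ (P)^n` iff `¬ P^n ∣ D F`. [folklore] -/
theorem not_mem_span_singleton_pow_iff {k : Type*} [Field k] (P G : Polynomial k) (n : ℕ) :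
    G ∉ Ideal.span {P} ^ n ↔ ¬ P ^ n ∣ G := by
  rw [Ideal.span_singleton_pow, Ideal.mem_span_singleton]

end Curve

end Summit.ResolutionOfSingularities.ResolutionOfSingularities.Theorems.RadicialJung.CleanModels

end
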